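import Mathlib
import Summits.ValiantsHypothesis.ValiantsHypothesis.Theorems.RigidityForcesSymmetryRankRigidMinimalReprLaplaceFiveSeparatedCaptureTwoLines
import Summits.ValiantsHypothesis.ValiantsHypothesis.Theorems.RigidityForcesSymmetryRankRigidMinimalReprLaplaceFiveSeparatedCaptureLinesK1
import Summits.ValiantsHypothesis.ValiantsHypothesis.Theorems.RigidityForcesSymmetryRankRigidMinimalReprLaplaceFiveSeparatedCaptureReduction

/-!
# ValiantsHypothesis / RigidityForcesSymmetry — crux `LaplaceOptimalFive` (stmt-ValiantsHypothesis-24813), symmetric capture: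
# ★★ **`CaptureIneqSym` FOR THE NESTED-LINE PROFILE `(1,2,2)♭`** (a line `ℂu` and two spans `V, V′ ∋ u` of dimension `≤ 2`)

Brick N1 of the K1 lane (val-lit-p6 g18 ↔ crit-3 g9, 2026-08-29; census of record: true capacity `≤ 3` of the target `5`).
Setting: `u ≠ 0` symmetric on the cut `{0,1}`, symmetric spans `V ∋ u`, `V′ ∋ u` with `finrank ≤ 2` on the cuts `{0,2}`, `{1,2}` —
the FULLY PAIRWISE-INTERSECTING profile left open by ✓ `captureIneqSym_of_two_lines` (two lines) and ✓ `…_of_disjoint_pair_four`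
(disjoint pairs).  Route («two pencils + joint square-free vanishing»):

* by ✓ `L3_finite_form`, `T_μ(p,q,r) = a_r u(p,q) + B_q(p,r) + C_p(q,r)` with `B_q ∈ V`, `C_p ∈ V′`; the slot symmetries `(2 3)`
  (with `C_p` symmetric) and `(1 3)` (with `B_q` symmetric) of the obligation make the pencils `G_x := a_x u − B_x` and
  `G′_x := a_x u − C_x` FULLY symmetric, with slices in `V` resp. `V′` BECAUSE `u ∈ V ⊓ V′` — so `G ∈ prolong V`, `G′ ∈ prolong V′`
  and `T_μ = Sym(u ⊗ a) − G − G′`;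
* **Lemma Y** (`prolong_triple_sqfree_eq_zero`, stated for THREE symmetric spans of `finrank ≤ 2` inside an abstract ambient space
  `X` of `finrank ≤ 3` — the shape the `(2,2,2)♭` triangle / two-equal-plus-line hands can reuse; `prolong_sup_sqfree_eq_zero` = the
  two-plane instance `X = V ⊔ V′`): a square-free element of `prolong V₁ + prolong V₂ + prolong V₃` vanishes — a nonzero symmetric
  square-free tensor has three independent zero-diagonal slices at an injective support entry, a matrix of `X` with a nonzero
  diagonal entry would be a fourth (`diag_eq_zero_of_sqfree_slices`), so `X` is zero-diagonal, each summand is square-free, and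
  ✓ `sqfree_slices_in_plane_eq_zero` kills it;
* counting on the representation space `ℂ⁵ × (prolong V ⊔ prolong V′)` in the ✓ R1 pattern (✓ `finrank_map_le_of_ker_le`,
  ✓ `hub_injective`): the kernel of the `ℂ⁵`-projection meets the obligations trivially by Lemma Y ⇒ `finrank W ≤ 5`
  (`finrank_le_five_of_line_in_two_planes`); the sub-cases `finrank V ≤ 1` / `finrank V′ ≤ 1` (then `= ℂu`) are
  ✓ `captureIneqSym_of_two_lines` with equal lines (✓ `contractZ_mem_L3_swap23` for the second).

* `exists_inj_of_sqfree_ne_zero`, `diag_eq_zero_of_sqfree_slices` — plumbing / the zero-diagonal lemma.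
* ★ `prolong_triple_sqfree_eq_zero` — Lemma Y (abstract, three summands); `prolong_sup_sqfree_eq_zero` — two planes.
* ★ `finrank_le_five_of_line_in_two_planes` — the count.
* ★★ `captureIneqSym_of_line_in_two_planes` — the profile theorem (crit-3 g9's N1 signature).

Honest framing.  `(SC)` = `CaptureIneqSym` for the profile `(1,2,2)♭` only; the profile `(2,2,2)♭` (three planes meeting pairwise in
lines, not all equal), every profile with a span of `finrank ≥ 3` outside ✓ `…_of_disjoint_pair_four`, `CaptureIneqSym` in general,
K1 on `K₃ ⊔ K₂`, `LaplaceOptimalFive` (OPEN · CONTESTED 72/120), `RankRigidMinimalRepr` and `VP ≠ VNP` are NOT proved here.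
No definitions, no `sorry`.
-/

set_option linter.dupNamespace false
set_option autoImplicit false

namespace Summit.ValiantsHypothesis.ValiantsHypothesis.Theorems.RigidityForcesSymmetryRankRigidMinimalRepr

namespace LaplaceFiveSeparatedCapture

open Finset

/-- A nonzero symmetric square-free 3-tensor has a nonzero entry at an injective triple (plumbing). [folklore] -/
theorem exists_inj_of_sqfree_ne_zero (g : Fin 5 → Fin 5 → Fin 5 → ℂ)
    (h12 : ∀ p q r, g p q r = g q p r) (h23 : ∀ p q r, g p q r = g p r q) (hsq : ∀ p r, g p p r = 0) (hne : g ≠ 0) :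
    ∃ i j k : Fin 5, i ≠ j ∧ i ≠ k ∧ j ≠ k ∧ g i j k ≠ 0 := by
  by_contra hcon
  push Not at hcon
  apply hne
  funext p q r
  by_cases hpq : p = q
  · subst hpq; exact hsq p r
  by_cases hpr : p = r
  · subst hpr; rw [h23, hsq]; rfl
  by_cases hqr : q = r
  · subst hqr; rw [h12, h23, hsq]; rfl
  exact hcon p q r hpq hpr hqr

/-- **Zero-diagonal lemma.**  If a nonzero symmetric square-free 3-tensor has all its slices in a space `X` of matrices with
`finrank X ≤ 3`, then every matrix in `X` has zero diagonal: the three slices at an injective support entry are independent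
zero-diagonal matrices, and a matrix of `X` with a nonzero diagonal entry would be a fourth independent vector. [folklore] -/
theorem diag_eq_zero_of_sqfree_slices (X : Submodule ℂ (Fin 5 → Fin 5 → ℂ)) (hX : Module.finrank ℂ X ≤ 3)
    (g : Fin 5 → Fin 5 → Fin 5 → ℂ) (h12 : ∀ p q r, g p q r = g q p r) (h23 : ∀ p q r, g p q r = g p r q)
    (hsq : ∀ p r, g p p r = 0) (hne : g ≠ 0) (hg : ∀ p, g p ∈ X) (x : Fin 5 → Fin 5 → ℂ) (hx : x ∈ X) (q : Fin 5) :
    x q q = 0 := by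
  classical
  obtain ⟨i, j, k, hij, hik, hjk, hijk⟩ := exists_inj_of_sqfree_ne_zero g h12 h23 hsq hne
  by_contra hxq
  -- entries of the slices used below
  have hd : ∀ p s : Fin 5, g p s s = 0 := fun p s => by rw [h12 p s s, h23 s p s]; exact hsq s p
  have e1 : g j j k = 0 := hsq j k
  have e2 : g k j k = 0 := by rw [h23]; exact hsq k j
  have e3 : g i i k = 0 := hsq i k
  have e4 : g k i k = 0 := by rw [h23]; exact hsq k i
  have e5 : g i i j = 0 := hsq i j
  have e6 : g j i j = 0 := by rw [h23]; exact hsq j i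
  have e7 : g j i k = g i j k := (h12 i j k).symm
  have e8 : g k i j = g i j k := by rw [h12 k i j, h23 i k j]
  -- the family `(g i, g j, g k, x)` in `X` is linearly independent
  let f : Fin 4 → X := ![⟨g i, hg i⟩, ⟨g j, hg j⟩, ⟨g k, hg k⟩, ⟨x, hx⟩]
  have hli : LinearIndependent ℂ f := by
    rw [Fintype.linearIndependent_iff]
    intro c hc m
    have hc' : ∀ a b : Fin 5, c 0 * g i a b + c 1 * g j a b + c 2 * g k a b + c 3 * x a b = 0 := by
      intro a b
      have := congrArg (fun y : X => (y : Fin 5 → Fin 5 → ℂ) a b) hc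
      simpa [f, Fin.sum_univ_four] using this
    have h3 : c 3 = 0 := by
      have := hc' q q
      rw [hd i q, hd j q, hd k q] at this
      have : c 3 * x q q = 0 := by linear_combination this
      exact (mul_eq_zero.mp this).resolve_right hxq
    have h0 : c 0 = 0 := by
      have := hc' j k
      rw [e1, e2, h3] at this
      have : c 0 * g i j k = 0 := by linear_combination this
      exact (mul_eq_zero.mp this).resolve_right hijk
    have h1 : c 1 = 0 := by
      have := hc' i k
      rw [e3, e7, e4, h3] at this
      have : c 1 * g i j k = 0 := by linear_combination this
      exact (mul_eq_zero.mp this).resolve_right hijk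
    have h2 : c 2 = 0 := by
      have := hc' i j
      rw [e5, e6, e8, h3] at this
      have : c 2 * g i j k = 0 := by linear_combination this
      exact (mul_eq_zero.mp this).resolve_right hijk
    fin_cases m
    · exact h0
    · exact h1
    · exact h2
    · exact h3
  have := hli.fintype_card_le_finrank
  simp only [Fintype.card_fin] at this
  omega

/-- ★ **LEMMA Y — JOINT SQUARE-FREE VANISHING OF PROLONGATIONS (three summands, abstract ambient 3-space).**  Let `X` be a
space of matrices with `finrank X ≤ 3` containing three symmetric spans `V₁, V₂, V₃` of `finrank ≤ 2` (e.g. two planes sharing a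
line, `V₃ = V₂`; or three planes meeting pairwise in lines inside a 3-space).  If `Gᵢ ∈ prolong Vᵢ` and `G₁ + G₂ + G₃` is square-free,
then `G₁ + G₂ + G₃ = 0`: otherwise the zero-diagonal lemma makes `X` zero-diagonal, so each `Gᵢ` is itself square-free (full
symmetry moves a repeated pair onto a slice diagonal) and vanishes by ✓ `sqfree_slices_in_plane_eq_zero`
(+ ✓ `exists_pair_of_finrank_le_two`). [folklore] -/
theorem prolong_triple_sqfree_eq_zero (X : Submodule ℂ (Fin 5 → Fin 5 → ℂ)) (hX : Module.finrank ℂ X ≤ 3)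
    (V₁ V₂ V₃ : Submodule ℂ (Fin 5 → Fin 5 → ℂ)) (h₁X : V₁ ≤ X) (h₂X : V₂ ≤ X) (h₃X : V₃ ≤ X)
    (hV₁ : ∀ x ∈ V₁, ∀ p q : Fin 5, x p q = x q p) (hV₂ : ∀ x ∈ V₂, ∀ p q : Fin 5, x p q = x q p)
    (hV₃ : ∀ x ∈ V₃, ∀ p q : Fin 5, x p q = x q p)
    (h₁ : Module.finrank ℂ V₁ ≤ 2) (h₂ : Module.finrank ℂ V₂ ≤ 2) (h₃ : Module.finrank ℂ V₃ ≤ 2)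
    (G₁ G₂ G₃ : Fin 5 → Fin 5 → Fin 5 → ℂ) (hG₁ : G₁ ∈ prolong V₁) (hG₂ : G₂ ∈ prolong V₂) (hG₃ : G₃ ∈ prolong V₃)
    (hsq : ∀ p r, (G₁ + G₂ + G₃) p p r = 0) : G₁ + G₂ + G₃ = 0 := by
  classical
  -- a square-free member of the prolongation of a symmetric plane vanishes
  have key : ∀ (U : Submodule ℂ (Fin 5 → Fin 5 → ℂ)), (∀ x ∈ U, ∀ p q : Fin 5, x p q = x q p) →
      Module.finrank ℂ U ≤ 2 → ∀ H ∈ prolong U, (∀ p r, H p p r = 0) → H = 0 := by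
    intro U hU hU2 H hH hHsq
    obtain ⟨v, v', hv, hv', hUv⟩ := exists_pair_of_finrank_le_two U hU hU2
    obtain ⟨hH12, hH23, hHs⟩ := (mem_prolong_iff U H).mp hH
    have hc : ∀ p, ∃ c c' : ℂ, H p = c • v + c' • v' := fun p => hUv _ (hHs p)
    choose c c' hcc using hc
    funext r a b
    refine sqfree_slices_in_plane_eq_zero v v' hv hv' (fun a b r => H r a b) (fun a b r => ?_) (fun a b r => ?_)
      (fun a r => ?_) c c' (fun a b r => ?_) a b r
    · show H r a b = H r b a
      exact hH23 r a b
    · show H r a b = H b a r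
      rw [hH12 r a b, hH23 a r b, hH12 a b r]
    · show H r a a = 0
      rw [hH12 r a a, hH23 a r a]; exact hHsq a r
    · show H r a b = c r * v a b + c' r * v' a b
      rw [hcc r]; simp only [Pi.add_apply, Pi.smul_apply, smul_eq_mul]
  -- square-freeness of a single prolongation element from the zero diagonal of its slices
  have sqf : ∀ (U : Submodule ℂ (Fin 5 → Fin 5 → ℂ)) (H : Fin 5 → Fin 5 → Fin 5 → ℂ), H ∈ prolong U →
      (∀ r p, H r p p = 0) → ∀ p r, H p p r = 0 := by
    intro U H hH hd p r
    obtain ⟨hH12, hH23, -⟩ := (mem_prolong_iff U H).mp hH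
    rw [hH23 p p r, hH12 p r p]
    exact hd r p
  by_contra hne
  obtain ⟨hG12₁, hG23₁, hGs₁⟩ := (mem_prolong_iff V₁ G₁).mp hG₁
  obtain ⟨hG12₂, hG23₂, hGs₂⟩ := (mem_prolong_iff V₂ G₂).mp hG₂
  obtain ⟨hG12₃, hG23₃, hGs₃⟩ := (mem_prolong_iff V₃ G₃).mp hG₃
  have g12 : ∀ p q r, (G₁ + G₂ + G₃) p q r = (G₁ + G₂ + G₃) q p r := fun p q r => by
    simp only [Pi.add_apply, hG12₁ p q r, hG12₂ p q r, hG12₃ p q r]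
  have g23 : ∀ p q r, (G₁ + G₂ + G₃) p q r = (G₁ + G₂ + G₃) p r q := fun p q r => by
    simp only [Pi.add_apply, hG23₁ p q r, hG23₂ p q r, hG23₃ p q r]
  have gsl : ∀ p, (G₁ + G₂ + G₃) p ∈ X := fun p => by
    rw [Pi.add_apply, Pi.add_apply]
    exact X.add_mem (X.add_mem (h₁X (hGs₁ p)) (h₂X (hGs₂ p))) (h₃X (hGs₃ p))
  have hdiag := diag_eq_zero_of_sqfree_slices X hX (G₁ + G₂ + G₃) g12 g23 hsq hne gsl
  -- each summand is square-free, hence zero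
  have hz₁ : G₁ = 0 := key V₁ hV₁ h₁ G₁ hG₁ (sqf V₁ G₁ hG₁ fun r p => hdiag (G₁ r) (h₁X (hGs₁ r)) p)
  have hz₂ : G₂ = 0 := key V₂ hV₂ h₂ G₂ hG₂ (sqf V₂ G₂ hG₂ fun r p => hdiag (G₂ r) (h₂X (hGs₂ r)) p)
  have hz₃ : G₃ = 0 := key V₃ hV₃ h₃ G₃ hG₃ (sqf V₃ G₃ hG₃ fun r p => hdiag (G₃ r) (h₃X (hGs₃ r)) p)
  exact hne (by rw [hz₁, hz₂, hz₃, add_zero, add_zero])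

/-- **Lemma Y for two planes sharing a line** (the shape used by the count): `finrank (V ⊔ V′) ≤ 3`, `G ∈ prolong V`,
`G′ ∈ prolong V′`, `G + G′` square-free ⇒ `G + G′ = 0`. [folklore] -/
theorem prolong_sup_sqfree_eq_zero (V V' : Submodule ℂ (Fin 5 → Fin 5 → ℂ))
    (hV : ∀ x ∈ V, ∀ p q : Fin 5, x p q = x q p) (hV' : ∀ x ∈ V', ∀ p q : Fin 5, x p q = x q p)
    (h2 : Module.finrank ℂ V ≤ 2) (h2' : Module.finrank ℂ V' ≤ 2) (h3 : Module.finrank ℂ ↥(V ⊔ V') ≤ 3)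
    (G G' : Fin 5 → Fin 5 → Fin 5 → ℂ) (hG : G ∈ prolong V) (hG' : G' ∈ prolong V')
    (hsq : ∀ p r, (G + G') p p r = 0) : G + G' = 0 := by
  have h := prolong_triple_sqfree_eq_zero (V ⊔ V') h3 V V' V' le_sup_left le_sup_right le_sup_right hV hV' hV' h2 h2' h2'
    G G' 0 hG hG' (Submodule.zero_mem _) (by rw [add_zero]; exact hsq)
  rw [add_zero] at h
  exact h

/-- **MAIN COUNT for the nested-line profile.**  `u ∈ V ⊓ V′` symmetric, `V, V′` symmetric of `finrank ≤ 2` with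
`finrank (V ⊔ V′) ≤ 3`, `W` symmetric zero-diagonal captured by `L3 (ℂu) V V′` ⇒ `finrank W ≤ 5`.  Every obligation reads
`T_μ = Sym(u ⊗ a) − G − G′` with `G ∈ prolong V`, `G′ ∈ prolong V′` (the two pencils of ✓ `L3_finite_form`'s representation), and
on the representation space `ℂ⁵ × (prolong V ⊔ prolong V′)` the kernel of the `ℂ⁵`-projection meets the obligations trivially
(Lemma Y), so `finrank W ≤ finrank ℂ⁵` (✓ `finrank_map_le_of_ker_le`, ✓ `hub_injective`). [folklore] -/
theorem finrank_le_five_of_line_in_two_planes (u : Fin 5 → Fin 5 → ℂ) (hu : ∀ p q, u p q = u q p)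
    (V V' W : Submodule ℂ (Fin 5 → Fin 5 → ℂ))
    (hV : ∀ x ∈ V, ∀ p q : Fin 5, x p q = x q p) (hV' : ∀ x ∈ V', ∀ p q : Fin 5, x p q = x q p)
    (h2 : Module.finrank ℂ V ≤ 2) (h2' : Module.finrank ℂ V' ≤ 2) (h3 : Module.finrank ℂ ↥(V ⊔ V') ≤ 3)
    (huV : u ∈ V) (huV' : u ∈ V')
    (hWs : ∀ μ ∈ W, ∀ s t : Fin 5, μ s t = μ t s) (hWd : ∀ μ ∈ W, ∀ s : Fin 5, μ s s = 0)
    (hWc : ∀ μ ∈ W, contractZ μ ∈ L3 (ℂ ∙ u) V V') :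
    Module.finrank ℂ W ≤ 5 := by
  classical
  -- the representation space `X ∋ (a, g)`, the assembly map `Φ (a, g) = Sym(u ⊗ a) − g` and the projection `π (a, g) = a`
  let X := (Fin 5 → ℂ) × (Fin 5 → Fin 5 → Fin 5 → ℂ)
  let symU : (Fin 5 → ℂ) →ₗ[ℂ] (Fin 5 → Fin 5 → Fin 5 → ℂ) :=
    { toFun := fun a p q r => a p * u q r + a q * u p r + a r * u p q
      map_add' := fun a b => by
        funext p q r
        simp only [Pi.add_apply]
        ring
      map_smul' := fun c a => by
        funext p q r
        simp only [Pi.smul_apply, smul_eq_mul, RingHom.id_apply]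
        ring }
  let Φ : X →ₗ[ℂ] (Fin 5 → Fin 5 → Fin 5 → ℂ) := symU.comp (LinearMap.fst ℂ _ _) - LinearMap.snd ℂ _ _
  let π : X →ₗ[ℂ] (Fin 5 → ℂ) := LinearMap.fst ℂ _ _
  have hΦ : ∀ x : X, ∀ p q r, Φ x p q r = x.1 p * u q r + x.1 q * u p r + x.1 r * u p q - x.2 p q r :=
    fun x p q r => rfl
  have hπ : ∀ x : X, π x = x.1 := fun x => rfl
  let R : Submodule ℂ X := (W.map cZ).comap Φ ⊓ (prolong V ⊔ prolong V').comap (LinearMap.snd ℂ _ _)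
  -- the kernel of `π` on `R` lies in the kernel of `Φ` (Lemma Y)
  have hker : ∀ x ∈ R, π x = 0 → Φ x = 0 := by
    intro x hx hπ0
    obtain ⟨hxW, hxP⟩ := Submodule.mem_inf.mp hx
    rw [Submodule.mem_comap] at hxW hxP
    rw [hπ] at hπ0
    have hΦx : Φ x = -x.2 := by
      funext p q r
      rw [hΦ, hπ0, Pi.neg_apply, Pi.neg_apply, Pi.neg_apply]
      simp
    obtain ⟨μ, -, hμ⟩ := Submodule.mem_map.mp hxW
    rw [cZ_apply, hΦx] at hμ
    have hx2 : x.2 = -contractZ μ := by rw [hμ, neg_neg]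
    obtain ⟨G, hG, G', hG', hsum⟩ := Submodule.mem_sup.mp hxP
    have hsum' : G + G' = x.2 := hsum
    have hz : G + G' = 0 := prolong_sup_sqfree_eq_zero V V' hV hV' h2 h2' h3 G G' hG hG' fun p r => by
      rw [hsum', hx2, Pi.neg_apply, Pi.neg_apply, Pi.neg_apply, contractZ_rep12, neg_zero]
    rw [hΦx, ← hsum', hz, neg_zero]
  -- every obligation lies in `Φ(R)`: the two pencils of the finite-form representation
  have hmem : ∀ μ ∈ W, contractZ μ ∈ R.map Φ := by
    intro μ hμ
    obtain ⟨A, B, C, hA, hB, hC, hT⟩ := L3_finite_form (ℂ ∙ u) V V' (hWc μ hμ)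
    have ha : ∀ r, ∃ c : ℂ, c • u = A r := fun r => Submodule.mem_span_singleton.mp (hA r)
    choose a ha using ha
    have hA' : ∀ r p q, A r p q = a r * u p q := fun r p q => by
      rw [← ha r, Pi.smul_apply, Pi.smul_apply, smul_eq_mul]
    have hT' : ∀ p q r, contractZ μ p q r = a r * u p q + B q p r + C p q r := fun p q r => by rw [hT, hA']
    -- the pencils `G_x = a_x u − B_x ∈ V` and `G′_x = a_x u − C_x ∈ V′`
    let G : Fin 5 → Fin 5 → Fin 5 → ℂ := fun x y z => a x * u y z - B x y z
    let G' : Fin 5 → Fin 5 → Fin 5 → ℂ := fun x y z => a x * u y z - C x y z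
    have hGd : ∀ x y z, G x y z = a x * u y z - B x y z := fun _ _ _ => rfl
    have hGd' : ∀ x y z, G' x y z = a x * u y z - C x y z := fun _ _ _ => rfl
    have hG23 : ∀ x y z, G x y z = G x z y := fun x y z => by
      rw [hGd, hGd, hu y z, hV _ (hB x) y z]
    have hG23' : ∀ x y z, G' x y z = G' x z y := fun x y z => by
      rw [hGd', hGd', hu y z, hV' _ (hC x) y z]
    have hG13 : ∀ x y z, G x y z = G z y x := fun x y z => by
      have h := contractZ_swap23 μ y x z
      rw [hT', hT'] at h
      have hc := hV' _ (hC y) z x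
      rw [hGd, hGd]
      linear_combination h - hc
    have hG13' : ∀ x y z, G' x y z = G' z y x := fun x y z => by
      have h : contractZ μ z y x = contractZ μ x y z := by
        rw [contractZ_swap12 μ y z x, contractZ_swap23 μ y x z, contractZ_swap12 μ x y z]
      rw [hT', hT', hu z y, hu x y] at h
      have hb := hV _ (hB y) z x
      rw [hGd', hGd']
      linear_combination h - hb
    have hG12 : ∀ x y z, G x y z = G y x z := fun x y z => by rw [hG23 y x z, hG13 y z x, hG23 x z y]
    have hG12' : ∀ x y z, G' x y z = G' y x z := fun x y z => by rw [hG23' y x z, hG13' y z x, hG23' x z y]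
    have hGp : G ∈ prolong V := by
      refine (mem_prolong_iff V G).mpr ⟨hG12, hG23, fun x => ?_⟩
      have e : G x = a x • u - B x := by
        funext y z
        rw [hGd, Pi.sub_apply, Pi.sub_apply, Pi.smul_apply, Pi.smul_apply, smul_eq_mul]
      rw [e]
      exact V.sub_mem (V.smul_mem _ huV) (hB x)
    have hGp' : G' ∈ prolong V' := by
      refine (mem_prolong_iff V' G').mpr ⟨hG12', hG23', fun x => ?_⟩
      have e : G' x = a x • u - C x := by
        funext y z
        rw [hGd', Pi.sub_apply, Pi.sub_apply, Pi.smul_apply, Pi.smul_apply, smul_eq_mul]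
      rw [e]
      exact V'.sub_mem (V'.smul_mem _ huV') (hC x)
    have hrep : Φ (a, G + G') = contractZ μ := by
      funext p q r
      rw [hΦ, hT' p q r]
      show a p * u q r + a q * u p r + a r * u p q - (G p q r + G' p q r) = a r * u p q + B q p r + C p q r
      rw [hG12 p q r, hGd, hGd']
      ring
    refine Submodule.mem_map.mpr ⟨(a, G + G'), Submodule.mem_inf.mpr ⟨?_, ?_⟩, hrep⟩
    · rw [Submodule.mem_comap, hrep]
      exact Submodule.mem_map.mpr ⟨μ, hμ, cZ_apply μ⟩
    · rw [Submodule.mem_comap]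
      exact Submodule.mem_sup.mpr ⟨G, hGp, G', hGp', rfl⟩
  -- counting
  let f : W →ₗ[ℂ] (R.map Φ) := LinearMap.codRestrict (R.map Φ) (cZ.domRestrict W) (fun μ => by
    simpa [cZ_apply] using hmem μ.1 μ.2)
  have hf : Function.Injective f := by
    rw [injective_iff_map_eq_zero]
    intro μ hμ
    have hT : contractZ μ.1 = 0 := by
      have := congrArg Subtype.val hμ
      simpa [f, cZ_apply] using this
    apply Subtype.ext
    refine hub_injective μ.1 (hWs μ.1 μ.2) (hWd μ.1 μ.2) fun p q => ?_
    simp [hT]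
  have h1 := LinearMap.finrank_le_finrank_of_injective hf
  have h2r := finrank_map_le_of_ker_le Φ π R hker
  have h3r : Module.finrank ℂ (R.map π) ≤ 5 := by
    have := Submodule.finrank_le (R.map π)
    rw [Module.finrank_fin_fun] at this
    exact this
  omega

/-- ★★ **`CaptureIneqSym` FOR THE NESTED-LINE PROFILE `(1,2,2)♭`: a line `ℂu` on the cut `{0,1}` lying in both spans `V ∋ u`,
`V′ ∋ u` (symmetric, `finrank ≤ 2`) on the cuts `{0,2}`, `{1,2}`.**  Then `finrank W ≤ finrank (ℂu) + finrank V + finrank V′`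
for every space `W` of symmetric zero-diagonal leaf matrices captured by `L3 (ℂu) V V′`.  Planes: the main count (`≤ 5`);
`V` or `V′` a line (then `= ℂu`): ✓ `captureIneqSym_of_two_lines` with equal lines (after the rôle symmetry
✓ `contractZ_mem_L3_swap23` in the second case). [folklore] -/
theorem captureIneqSym_of_line_in_two_planes (u : Fin 5 → Fin 5 → ℂ) (hu : ∀ p q, u p q = u q p) (hu0 : u ≠ 0)
    (V V' W : Submodule ℂ (Fin 5 → Fin 5 → ℂ))
    (hV : ∀ x ∈ V, ∀ p q : Fin 5, x p q = x q p) (hV' : ∀ x ∈ V', ∀ p q : Fin 5, x p q = x q p)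
    (h2 : Module.finrank ℂ V ≤ 2) (h2' : Module.finrank ℂ V' ≤ 2) (huV : u ∈ V) (huV' : u ∈ V')
    (hWs : ∀ μ ∈ W, ∀ s t : Fin 5, μ s t = μ t s) (hWd : ∀ μ ∈ W, ∀ s : Fin 5, μ s s = 0)
    (hWc : ∀ μ ∈ W, contractZ μ ∈ L3 (ℂ ∙ u) V V') :
    Module.finrank ℂ W ≤ Module.finrank ℂ (ℂ ∙ u) + Module.finrank ℂ V + Module.finrank ℂ V' := by
  classical
  have h1 : Module.finrank ℂ (ℂ ∙ u) = 1 := finrank_span_singleton hu0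
  have hsym : ∀ x ∈ (ℂ ∙ u), ∀ p q : Fin 5, x p q = x q p := by
    intro x hx p q
    obtain ⟨c, rfl⟩ := Submodule.mem_span_singleton.mp hx
    simp only [Pi.smul_apply, smul_eq_mul, hu p q]
  have hleV : (ℂ ∙ u) ≤ V := (Submodule.span_singleton_le_iff_mem u V).mpr huV
  have hleV' : (ℂ ∙ u) ≤ V' := (Submodule.span_singleton_le_iff_mem u V').mpr huV'
  by_cases hV1 : Module.finrank ℂ V ≤ 1
  · -- `V = ℂu`: two equal lines and the span `V′`
    have heq : (ℂ ∙ u) = V := Submodule.eq_of_le_of_finrank_le hleV (by omega)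
    subst heq
    exact captureIneqSym_of_two_lines u u hu hu hu0 hu0 V' W hV' h2' hWs hWd hWc
  by_cases hV1' : Module.finrank ℂ V' ≤ 1
  · -- `V′ = ℂu`: move `V` to the third cut and use two equal lines
    have heq : (ℂ ∙ u) = V' := Submodule.eq_of_le_of_finrank_le hleV' (by omega)
    subst heq
    have hWc' : ∀ μ ∈ W, contractZ μ ∈ L3 (ℂ ∙ u) (ℂ ∙ u) V :=
      fun μ hμ => contractZ_mem_L3_swap23 _ _ _ hsym μ (hWc μ hμ)
    have := captureIneqSym_of_two_lines u u hu hu hu0 hu0 V W hV h2 hWs hWd hWc'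
    omega
  -- two planes through the line: the main count
  have hinf : 1 ≤ Module.finrank ℂ ↥(V ⊓ V') := h1 ▸ Submodule.finrank_mono (le_inf hleV hleV')
  have hsup := Submodule.finrank_sup_add_finrank_inf_eq V V'
  have h3 : Module.finrank ℂ ↥(V ⊔ V') ≤ 3 := by omega
  have := finrank_le_five_of_line_in_two_planes u hu V V' W hV hV' h2 h2' h3 huV huV' hWs hWd hWc
  omega

end LaplaceFiveSeparatedCapture

end Summit.ValiantsHypothesis.ValiantsHypothesis.Theorems.RigidityForcesSymmetryRankRigidMinimalRepr
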